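import Mathlib
import Summits.Ventures.PercRepro2.Independence
import Summits.Ventures.PercRepro2.Harris
import Summits.Ventures.PercRepro2.HCov
import Summits.Ventures.PercRepro2.CutVertexPaths
import Summits.Ventures.PercRepro2.CutOneFarConn
import Summits.Ventures.PercRepro2.CutTwoFarConn
import Summits.Ventures.PercRepro2.CutTwoFarLaw
import Summits.Ventures.PercRepro2.CutTwoFar
import Summits.Ventures.PercRepro2.CutTwoFarHarris
import Summits.Ventures.PercRepro2.CutTwoFarRootsLaw

/-!
# Two marks behind a cut vertex, V: THE RIGHT PATTERN ON FOUR POINTS (blind cell PercRepro2,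
typer-1 g50)

The joint law of the left pattern of `{v, w₁, w₂}` and the RIGHT PATTERN of `{v, y₁, y₂, y₃}` —
the six right connections `(v,y₁), (v,y₂), (v,y₃), (y₁,y₂), (y₁,y₃), (y₂,y₃)` as a vector
`rpat ω : Fin 6 → Bool` — for the two-far-mark classes in which the three right marks are joined
among themselves as well (`o, b` far: T3; `a₃, b` far: T4; …).  The right pattern is transitive
(`rpat_mem_transSix`: it lies among the FIFTEEN set partitions `transSix`), its atoms `ratom`
sum to one, the left pattern and the right pattern are independent (`prob_pat_and_rpat`), and
every event that is a Boolean function `Φ` of the two patterns has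
`P(S) = ∑_τ patProb τ · ∑_{ρ ∈ transSix} [Φ τ ρ] · ratom ρ` (**`prob_patLR`**, the fifteen-term
form `prob_patLR_trans`; the right-only `prob_R6`).  With two marks on the left and three on the
right, every mark connection is such a function (`conn_left_right_iff` of `CutTwoFarRootsLaw.lean`
and `conn_right_iff` here).  Own work; standard axioms.
-/

namespace Summit.Ventures.PercRepro2

open CovForm CutVertexM9

namespace CutTwoFar

section RightPat

variable {V : Type*} {E : Type*} [Fintype E] [DecidableEq E] {R : Type*} [Field R]
variable (ends : E → Sym2 V) (side : E → Bool) (v y₁ y₂ y₃ : V)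

open scoped Classical in
/-- The right pattern of `{v, y₁, y₂, y₃}`: the six right connections
`(v,y₁), (v,y₂), (v,y₃), (y₁,y₂), (y₁,y₃), (y₂,y₃)`. -/
noncomputable def rpat (ω : Config E) : Fin 6 → Bool :=
  ![Rb ends side v y₁ ω, Rb ends side v y₂ ω, Rb ends side v y₃ ω,
    decide (Conn ends (CutVertexM9.restrict side false ω) y₁ y₂),
    decide (Conn ends (CutVertexM9.restrict side false ω) y₁ y₃),
    decide (Conn ends (CutVertexM9.restrict side false ω) y₂ y₃)]

omit [Fintype E] [DecidableEq E] in
/-- The right pattern only reads the right edges. -/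
lemma rpat_eq_of_agree {ω ω' : Config E} (hag : ∀ e, side e = false → ω e = ω' e) :
    rpat ends side v y₁ y₂ y₃ ω = rpat ends side v y₁ y₂ y₃ ω' := by
  unfold rpat
  rw [Rb_eq_of_agree ends side v y₁ hag, Rb_eq_of_agree ends side v y₂ hag,
    Rb_eq_of_agree ends side v y₃ hag, CutVertexM9.restrict_eq_of_agree hag]

omit [Fintype E] [DecidableEq E] in
/-- The bits of the right pattern. -/
lemma rpat_zero_iff (ω : Config E) :
    rpat ends side v y₁ y₂ y₃ ω 0 = true ↔ Conn ends (CutVertexM9.restrict side false ω) v y₁ := by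
  simp [rpat, Rb]

omit [Fintype E] [DecidableEq E] in
/-- The bits of the right pattern. -/
lemma rpat_one_iff (ω : Config E) :
    rpat ends side v y₁ y₂ y₃ ω 1 = true ↔ Conn ends (CutVertexM9.restrict side false ω) v y₂ := by
  simp [rpat, Rb]

omit [Fintype E] [DecidableEq E] in
/-- The bits of the right pattern. -/
lemma rpat_two_iff (ω : Config E) :
    rpat ends side v y₁ y₂ y₃ ω 2 = true ↔ Conn ends (CutVertexM9.restrict side false ω) v y₃ := by
  simp [rpat, Rb]

omit [Fintype E] [DecidableEq E] in
/-- The bits of the right pattern. -/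
lemma rpat_three_iff (ω : Config E) :
    rpat ends side v y₁ y₂ y₃ ω 3 = true ↔
      Conn ends (CutVertexM9.restrict side false ω) y₁ y₂ := by
  simp [rpat]

omit [Fintype E] [DecidableEq E] in
/-- The bits of the right pattern. -/
lemma rpat_four_iff (ω : Config E) :
    rpat ends side v y₁ y₂ y₃ ω 4 = true ↔
      Conn ends (CutVertexM9.restrict side false ω) y₁ y₃ := by
  simp [rpat]

omit [Fintype E] [DecidableEq E] in
/-- The bits of the right pattern. -/
lemma rpat_five_iff (ω : Config E) :
    rpat ends side v y₁ y₂ y₃ ω 5 = true ↔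
      Conn ends (CutVertexM9.restrict side false ω) y₂ y₃ := by
  simp [rpat]

/-- The transitivity test of a six-bit pattern: each of the four triples is closed. -/
def transSixB (ρ : Fin 6 → Bool) : Bool :=
  (!(ρ 0 && ρ 1) || ρ 3) && (!(ρ 0 && ρ 3) || ρ 1) && (!(ρ 1 && ρ 3) || ρ 0) &&
  (!(ρ 0 && ρ 2) || ρ 4) && (!(ρ 0 && ρ 4) || ρ 2) && (!(ρ 2 && ρ 4) || ρ 0) &&
  (!(ρ 1 && ρ 2) || ρ 5) && (!(ρ 1 && ρ 5) || ρ 2) && (!(ρ 2 && ρ 5) || ρ 1) &&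
  (!(ρ 3 && ρ 4) || ρ 5) && (!(ρ 3 && ρ 5) || ρ 4) && (!(ρ 4 && ρ 5) || ρ 3)

/-- The fifteen transitive right patterns (the set partitions of `{v, y₁, y₂, y₃}`). -/
def transSix : Finset (Fin 6 → Bool) :=
  {![true, true, true, true, true, true],
    ![true, true, false, true, false, false],
    ![true, false, true, false, true, false],
    ![true, false, false, false, false, true],
    ![true, false, false, false, false, false],
    ![false, true, true, false, false, true],
    ![false, true, false, false, true, false],
    ![false, true, false, false, false, false],
    ![false, false, true, true, false, false],
    ![false, false, true, false, false, false],
    ![false, false, false, true, true, true],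
    ![false, false, false, true, false, false],
    ![false, false, false, false, true, false],
    ![false, false, false, false, false, true],
    ![false, false, false, false, false, false]}

/-- A six-bit pattern is transitive iff it is one of the fifteen. -/
lemma mem_transSix_iff (ρ : Fin 6 → Bool) : ρ ∈ transSix ↔ transSixB ρ = true := by
  revert ρ
  decide

/-- A closed triple, in the form the transitivity test takes. -/
lemma or_of_imp {A B C : Prop} (h : A → B → C) : ¬ (A ∧ B) ∨ C := by
  by_cases hAB : A ∧ B
  · exact Or.inr (h hAB.1 hAB.2)
  · exact Or.inl hAB

omit [Fintype E] [DecidableEq E] in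
/-- **The right pattern is transitive.** -/
lemma rpat_mem_transSix (ω : Config E) : rpat ends side v y₁ y₂ y₃ ω ∈ transSix := by
  rw [mem_transSix_iff, transSixB]
  simp only [Bool.and_eq_true, Bool.or_eq_true, Bool.not_eq_true', Bool.eq_false_iff, ne_eq,
    rpat_zero_iff, rpat_one_iff, rpat_two_iff, rpat_three_iff, rpat_four_iff, rpat_five_iff]
  refine ⟨⟨⟨⟨⟨⟨⟨⟨⟨⟨⟨?_, ?_⟩, ?_⟩, ?_⟩, ?_⟩, ?_⟩, ?_⟩, ?_⟩, ?_⟩, ?_⟩, ?_⟩, ?_⟩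
  all_goals first
    | exact or_of_imp (fun h1 h2 => conn_trans (conn_symm h1) h2)
    | exact or_of_imp (fun h1 h2 => conn_trans h1 h2)
    | exact or_of_imp (fun h1 h2 => conn_trans h1 (conn_symm h2))

/-- The right atoms: the law of the right pattern. -/
noncomputable def ratom (p : E → R) (ρ : Fin 6 → Bool) : R :=
  prob p {ω | rpat ends side v y₁ y₂ y₃ ω = ρ}

/-- A non-transitive pattern has probability `0`. -/
lemma ratom_eq_zero_of_not_mem (p : E → R) {ρ : Fin 6 → Bool} (hρ : ρ ∉ transSix) :
    ratom ends side v y₁ y₂ y₃ p ρ = 0 := by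
  have hempty : {ω : Config E | rpat ends side v y₁ y₂ y₃ ω = ρ} = ∅ := by
    ext ω
    simp only [Set.mem_setOf_eq, Set.mem_empty_iff_false, iff_false]
    rintro rfl
    exact hρ (rpat_mem_transSix ends side v y₁ y₂ y₃ ω)
  rw [ratom, hempty, prob_empty]

omit [Fintype E] [DecidableEq E] in
/-- The right-pattern events only read the right edges. -/
lemma dependsOn_rpat (ρ : Fin 6 → Bool) :
    DependsOn (· ∈ {ω : Config E | rpat ends side v y₁ y₂ y₃ ω = ρ}) {e | side e = false} := by
  intro ω ω' h
  simp only [Set.mem_setOf_eq]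
  rw [rpat_eq_of_agree ends side v y₁ y₂ y₃ h]

/-- **Independence of the left and the right pattern.** -/
theorem prob_pat_and_rpat (w₁ w₂ : V) (p : E → R) (τ : Fin 3 → Bool) (ρ : Fin 6 → Bool) :
    prob p {ω | pat ends side v w₁ w₂ ω = τ ∧ rpat ends side v y₁ y₂ y₃ ω = ρ} =
      patProb ends side v w₁ w₂ p τ * ratom ends side v y₁ y₂ y₃ p ρ := by
  have hdisj : Disjoint {e | side e = true} {e | side e = false} := by
    rw [Set.disjoint_left]
    intro e he he'
    simp only [Set.mem_setOf_eq] at he he'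
    rw [he] at he'
    exact Bool.false_ne_true he'.symm
  have hset : {ω : Config E | pat ends side v w₁ w₂ ω = τ ∧ rpat ends side v y₁ y₂ y₃ ω = ρ} =
      {ω | pat ends side v w₁ w₂ ω = τ} ∩ {ω | rpat ends side v y₁ y₂ y₃ ω = ρ} := by
    ext ω
    simp only [Set.mem_setOf_eq, Set.mem_inter_iff]
  rw [hset, prob_inter_eq_mul_of_dependsOn p hdisj (dependsOn_pat ends side v w₁ w₂ τ)
    (dependsOn_rpat ends side v y₁ y₂ y₃ ρ)]
  rfl

/-- **The joint law, applied**: an event that is a Boolean function of the two patterns. -/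
theorem prob_patLR (w₁ w₂ : V) (p : E → R) (S : Set (Config E))
    (Φ : (Fin 3 → Bool) → (Fin 6 → Bool) → Prop) [∀ τ ρ, Decidable (Φ τ ρ)]
    (hS : ∀ ω, ω ∈ S ↔ Φ (pat ends side v w₁ w₂ ω) (rpat ends side v y₁ y₂ y₃ ω)) :
    prob p S = ∑ τ, patProb ends side v w₁ w₂ p τ *
      ∑ ρ, if Φ τ ρ then ratom ends side v y₁ y₂ y₃ p ρ else 0 := by
  classical
  rw [prob_eq_sum_fibres p (fun ω => (pat ends side v w₁ w₂ ω, rpat ends side v y₁ y₂ y₃ ω)) S,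
    Fintype.sum_prod_type]
  refine Finset.sum_congr rfl fun τ _ => ?_
  rw [Finset.mul_sum]
  refine Finset.sum_congr rfl fun ρ _ => ?_
  by_cases hΦ : Φ τ ρ
  · rw [if_pos hΦ, ← prob_pat_and_rpat]
    congr 1
    ext ω
    simp only [Set.mem_inter_iff, Set.mem_setOf_eq, Prod.mk.injEq, hS ω]
    constructor
    · rintro ⟨_, h1, h2⟩
      exact ⟨h1, h2⟩
    · rintro ⟨h1, h2⟩
      exact ⟨by rw [h1, h2]; exact hΦ, h1, h2⟩
  · rw [if_neg hΦ, mul_zero]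
    have : S ∩ {ω | (pat ends side v w₁ w₂ ω, rpat ends side v y₁ y₂ y₃ ω) = (τ, ρ)} = ∅ := by
      ext ω
      simp only [Set.mem_inter_iff, Set.mem_setOf_eq, Prod.mk.injEq, Set.mem_empty_iff_false,
        iff_false, not_and, hS ω]
      intro hφ h1 h2
      rw [h1, h2] at hφ
      exact hΦ hφ
    rw [this, prob_empty]

/-- The fifteen-term form of an `if`-mixture. -/
lemma sum_ite_ratom_eq_sum_transSix (p : E → R) (c : (Fin 6 → Bool) → Prop) [DecidablePred c] :
    ∑ ρ, (if c ρ then ratom ends side v y₁ y₂ y₃ p ρ else 0) =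
      ∑ ρ ∈ transSix, (if c ρ then ratom ends side v y₁ y₂ y₃ p ρ else 0) := by
  symm
  refine Finset.sum_subset (Finset.subset_univ _) fun ρ _ hρ => ?_
  rw [ratom_eq_zero_of_not_mem ends side v y₁ y₂ y₃ p hρ, ite_self]

/-- **The right-only law.** -/
theorem prob_R6 (p : E → R) (S : Set (Config E)) (Φ : (Fin 6 → Bool) → Prop)
    [∀ ρ, Decidable (Φ ρ)] (hS : ∀ ω, ω ∈ S ↔ Φ (rpat ends side v y₁ y₂ y₃ ω)) :
    prob p S = ∑ ρ, if Φ ρ then ratom ends side v y₁ y₂ y₃ p ρ else 0 := by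
  classical
  rw [prob_eq_sum_fibres p (rpat ends side v y₁ y₂ y₃) S]
  refine Finset.sum_congr rfl fun ρ _ => ?_
  by_cases hΦ : Φ ρ
  · rw [if_pos hΦ, ratom]
    congr 1
    ext ω
    simp only [Set.mem_inter_iff, Set.mem_setOf_eq, hS ω]
    constructor
    · rintro ⟨_, h⟩
      exact h
    · intro h
      exact ⟨by rw [h]; exact hΦ, h⟩
  · rw [if_neg hΦ]
    have : S ∩ {ω | rpat ends side v y₁ y₂ y₃ ω = ρ} = ∅ := by
      ext ω
      simp only [Set.mem_inter_iff, Set.mem_setOf_eq, Set.mem_empty_iff_false, iff_false, not_and,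
        hS ω]
      intro hφ h
      rw [h] at hφ
      exact hΦ hφ
    rw [this, prob_empty]

/-- **The right atoms sum to one.** -/
theorem ratom_sum (p : E → R) : ∑ ρ, ratom ends side v y₁ y₂ y₃ p ρ = 1 := by
  have h := prob_R6 ends side v y₁ y₂ y₃ p Set.univ (fun _ => True) (fun _ => by simp)
  simp only [prob_univ, if_true] at h
  exact h.symm

/-- The right atoms of the fifteen transitive patterns sum to one. -/
theorem ratom_sum_transSix (p : E → R) : ∑ ρ ∈ transSix, ratom ends side v y₁ y₂ y₃ p ρ = 1 := by
  have h := ratom_sum ends side v y₁ y₂ y₃ p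
  rw [← Finset.sum_subset (Finset.subset_univ transSix) fun ρ _ hρ =>
    ratom_eq_zero_of_not_mem ends side v y₁ y₂ y₃ p hρ] at h
  exact h

/-- The five transitive left patterns sum to one. -/
theorem sum_patProb_transPatterns (w₁ w₂ : V) (p : E → R) :
    ∑ τ ∈ transPatterns, patProb ends side v w₁ w₂ p τ = 1 := by
  have h := sum_patProb ends side v w₁ w₂ p
  rw [← Finset.sum_subset (Finset.subset_univ transPatterns) fun τ _ hτ =>
    patProb_eq_zero_of_nontransitive ends side v w₁ w₂ p (nontransitive_of_not_mem hτ)] at h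
  exact h

/-- The five transitive patterns, summed out. -/
lemma sum_transPatterns (f : (Fin 3 → Bool) → R) :
    ∑ τ ∈ transPatterns, f τ =
      f ![false, false, false] + f ![true, true, true] + f ![true, false, false] +
        f ![false, true, false] + f ![false, false, true] := by
  rw [transPatterns, Finset.sum_insert (by decide), Finset.sum_insert (by decide),
    Finset.sum_insert (by decide), Finset.sum_insert (by decide), Finset.sum_singleton]
  ring

/-- The fifteen transitive patterns, summed out. -/
lemma sum_transSix (f : (Fin 6 → Bool) → R) :
    ∑ ρ ∈ transSix, f ρ =
      f ![true, true, true, true, true, true] + f ![true, true, false, true, false, false] +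
      f ![true, false, true, false, true, false] + f ![true, false, false, false, false, true] +
      f ![true, false, false, false, false, false] + f ![false, true, true, false, false, true] +
      f ![false, true, false, false, true, false] + f ![false, true, false, false, false, false] +
      f ![false, false, true, true, false, false] + f ![false, false, true, false, false, false] +
      f ![false, false, false, true, true, true] + f ![false, false, false, true, false, false] +
      f ![false, false, false, false, true, false] + f ![false, false, false, false, false, true] +
      f ![false, false, false, false, false, false] := by
  rw [transSix, Finset.sum_insert (by decide), Finset.sum_insert (by decide),
    Finset.sum_insert (by decide), Finset.sum_insert (by decide), Finset.sum_insert (by decide),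
    Finset.sum_insert (by decide), Finset.sum_insert (by decide), Finset.sum_insert (by decide),
    Finset.sum_insert (by decide), Finset.sum_insert (by decide), Finset.sum_insert (by decide),
    Finset.sum_insert (by decide), Finset.sum_insert (by decide), Finset.sum_insert (by decide),
    Finset.sum_singleton]
  ring

end RightPat

/-! ## Mark connectivity: right marks among themselves -/

section RightConn

variable {V : Type*} {E : Type*} {ends : E → Sym2 V} {side : E → Bool} {L : Set V} {v : V}
  {Rt : Set V}

/-- Two right vertices: joined iff joined by right edges. -/
lemma conn_right_iff (h : CutVertex ends side L v Rt) {y z : V} (hy : y ∈ Rt ∨ y = v)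
    (hz : z ∈ Rt ∨ z = v) (ω : Config E) :
    Conn ends ω y z ↔ Conn ends (CutVertexM9.restrict side false ω) y z :=
  conn_iff_restrict_right h hy hz ω

end RightConn

end CutTwoFar

end Summit.Ventures.PercRepro2
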